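import Literature.Barriers.ResolutionOfSingularities.LocalMonomializationFails
import Literature.AlgebraicGeometry.Resolution.OriginTaylor
import Literature.AlgebraicGeometry.Resolution.QuadraticTransforms
import HarnessLib

/-!
# Cutkosky's Lemma 3.1: one block of `p` quadratic transforms in the counterexample

`Literature/Barriers/ResolutionOfSingularities/LocalMonomializationFailsLemma.lean` — the
computational heart of Cutkosky's counterexample to local monomialization
(`Literature.Barriers.ResolutionOfSingularities.Cutkosky.Cutkosky2014`, file
`LocalMonomializationFails.lean`), vendored as a NAMED FACT over the tree's real objects
(`originLocalRing` = `k[x,y]_{(x,y)}`, `originTaylorAt` = the expansion in `k[[x,y]]`,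
`IsQuadraticTransform`, `SubringDominates`, `Dominates`, `IsMonomialExtension`). Second named
sub-fact of the decomposition of the XL discharge of `Cutkosky2014` (the first being Abhyankar's
theorems, `QuadraticTransforms.lean`); its own discharge (two pages of computations with
leading forms and Weierstrass preparation in `k[[u,v]] → k[[x,y]]`) is a later target.

## What the source prints (arXiv:1404.7459 = Math. Ann. 362 (2015) 321–334, §3, verified on the page)

**Lemma 3.1.** "Suppose that `A` and `B` are two dimensional regular local rings containing a
common coefficient field `k` of characteristic `p` with at least three elements such that `B`
dominates `A`. Let `u, v` be regular parameters in `A` and `x, y` be regular parameters in `B`.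
Suppose that in `B̂ = k[[x,y]]` we have expressions
(4) `u = xᵖ(c₀ + f₀y + xΛ₀)`, `v = τ₀(y)yᵖ + e₀x + xΩ₀`
where `c₀, f₀, e₀ ∈ k` are nonzero, `τ₀(y) ∈ k[[y]]` is a unit series, `Λ₀, Ω₀ ∈ B̂` and
`ord_{B̂}(Ω₀) ≥ 1`. Let `τ̄₀ ∈ k` be the constant term of `τ₀(y)`. Suppose that `α ∈ k` is such
that `α ≠ 0` and `α ≠ −τ̄₀/e₀`. Consider the sequence of quadratic transforms
`B = B₀ → B₁ → ⋯ → B_p` where `B_i` has regular parameters `x_i, y_i` for `1 ≤ i ≤ p` defined by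
`x = x_i y_iⁱ, y = y_i` if `1 ≤ i < p` and `x = x_pᵖ(y_p + α), y = x_p`. Then `B_i` does not
dominate any quadratic transform of `A` for `0 ≤ i < p`. The sequence of quadratic transforms of
`A` which are dominated by `B_p` are `A = A₀ → A₁ → ⋯ → A_p`, `A_i` has regular parameters
`u_i, v_i`, defined by `u = u_i v_iⁱ, v = v_i` if `1 ≤ i < p`, and
`u = u_pᵖ(v_p + αᵖc₀/(τ̄₀ + αe₀)ᵖ), v = u_p`. In `B̂_p = k[[x_p, y_p]]` we have expressions
(5) `u_p = x_pᵖ(c_p + f_p y_p + x_pΛ_p)`, `v_p = τ_p(y_p)y_pᵖ + e_p x_p + x_pΩ_p` where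
`c_p, f_p, e_p ∈ k` are nonzero, `τ_p(y_p) ∈ k[[y_p]]` is a unit series, `Λ_p, Ω_p ∈ B̂_p` and
`ord_{B_p}(Ω_p) ≥ 1`, of the form of (4). Further, `A → B_i` is not monomial for `0 ≤ i < p`."
[cite: Cutkosky2014, Lemma 3.1]

## Lean rendering

The fact is vendored for the algebraic local rings that actually occur in §3 (and to which the
lemma is applied there): inside an `F`-field `L`, `A = F[u,v]_{(u,v)} = originLocalRing huv`
and `B = F[x,y]_{(x,y)} = originLocalRing hxy` for algebraically independent pairs — these ARE
two-dimensional regular local rings with coefficient field `F` and regular parameters `(u,v)`,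
`(x,y)` (`OriginLocalRing.lean`), so this is a special case of the printed lemma, never
stronger. `B̂ = k[[x,y]]` is `MvPowerSeries (Fin 2) F` via the Taylor expansion
`originTaylorAt hxy` (`x ↦ X 0`, `y ↦ X 1`); "`τ₀(y) ∈ k[[y]]`" is `IsSeriesInY`
(no coefficient involving `x`), "unit series" is `constantCoeff ≠ 0`, "`ord Ω ≥ 1`" is
`constantCoeff Ω = 0` (`LemmaShape`). The rings `B_i`, `A_i` are again `originLocalRing`s, on
the coordinates `bCoord`/`aCoord` read off the printed substitutions
(`x_i = x/yⁱ, y_i = y`; `x_p = y, y_p = x/yᵖ − α`; `u_i = u/vⁱ, v_i = v`; `u_p = v,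
v_p = u/vᵖ − β`, `β = αᵖc₀/(τ̄₀+αe₀)ᵖ`); their algebraic independence is supplied by the user
(`∀ h : AlgebraicIndependent …`), not asserted. Of the printed conclusions the fact keeps:
(C1) no quadratic transform of `A` (`IsQuadraticTransform`, Cutkosky §2.1) is dominated by
`B_i`, `0 ≤ i < p`; (C2) `B_p` dominates `A_p`; (C3) the expansions (5) hold in `B̂_p` for SOME
nonzero `c_p, f_p, e_p` and unit series `τ_p` (the printed explicit values
`c₁ = τ̄₀ + αe₀, f₁ = e₀, …` are not vendored); (C4) `A → B_i` is not monomial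
(`IsMonomialExtension`, Def. 1.1) for `0 ≤ i < p`. Dropped (weaker than printed): that the
`A_i → A_{i+1}` are quadratic transforms and that no other quadratic transforms of `A` are
dominated by `B_p` (the assembly re-derives what it needs from (C1) of the next block).
-/

noncomputable section

namespace Literature.Barriers.ResolutionOfSingularities

namespace Cutkosky

open Literature.AlgebraicGeometry.Resolution

universe u

section Defs

variable {F : Type u} [Field F] {L : Type u} [Field L] [Algebra F L]

/-- A power series `τ ∈ F[[x, y]]` "lies in `F[[y]]`": no monomial involving `x = X 0` occurs.
[cite: Cutkosky2014, Lemma 3.1 ("`τ₀(y) ∈ k[[y]]`")] -/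
def IsSeriesInY (τ : MvPowerSeries (Fin 2) F) : Prop :=
  ∀ m : Fin 2 →₀ ℕ, m 0 ≠ 0 → MvPowerSeries.coeff m τ = 0

/-- **The expansions (4) of Lemma 3.1** for elements `u, v` of `B = F[x,y]_{(x,y)}`, in
`B̂ = F[[x,y]]` (`x ↦ X 0`, `y ↦ X 1`): `u = xᵖ(c + f·y + x·Λ)` and `v = τ(y)·yᵖ + e·x + x·Ω`
with `c, f, e ≠ 0`, `τ(y) ∈ F[[y]]` a unit series and `ord Ω ≥ 1`.
[cite: Cutkosky2014, Lemma 3.1 (4)] -/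
def LemmaShape (p : ℕ) {xy : Fin 2 → L} (hxy : AlgebraicIndependent F xy)
    (u v : originLocalRing hxy) (c f e : F) (τ : MvPowerSeries (Fin 2) F) : Prop :=
  c ≠ 0 ∧ f ≠ 0 ∧ e ≠ 0 ∧ IsSeriesInY τ ∧ MvPowerSeries.constantCoeff τ ≠ 0 ∧
  (∃ Λ : MvPowerSeries (Fin 2) F, originTaylorAt hxy u =
      MvPowerSeries.X 0 ^ p * (MvPowerSeries.C c + MvPowerSeries.C f * MvPowerSeries.X 1 +
        MvPowerSeries.X 0 * Λ)) ∧
  (∃ Ω : MvPowerSeries (Fin 2) F, MvPowerSeries.constantCoeff Ω = 0 ∧ originTaylorAt hxy v =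
      τ * MvPowerSeries.X 1 ^ p + MvPowerSeries.C e * MvPowerSeries.X 0 + MvPowerSeries.X 0 * Ω)

variable (F L) in
/-- The coordinates of the quadratic transforms `B₀ → B₁ → ⋯ → B_p` of `B = F[x,y]_{(x,y)}` in
Lemma 3.1: `(x_i, y_i) = (x/yⁱ, y)` for `i < p` (from `x = x_i y_iⁱ, y = y_i`) and
`(x_p, y_p) = (y, x/yᵖ − α)` (from `x = x_pᵖ(y_p + α), y = x_p`); indices `> p` are not used
(set equal to the `p`-th). The same formula gives the `A_i` (`u = u_i v_iⁱ, v = v_i`;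
`u = u_pᵖ(v_p + β), v = u_p`). [cite: Cutkosky2014, Lemma 3.1] -/
def bCoord (p : ℕ) (x y : L) (α : F) (i : ℕ) : Fin 2 → L :=
  if i < p then ![x / y ^ i, y] else ![y, x / y ^ p - algebraMap F L α]

/-- The printed constant `β = αᵖ c₀ / (τ̄₀ + α e₀)ᵖ` of the `p`-th quadratic transform of `A`
(`u = u_pᵖ(v_p + β)`). [cite: Cutkosky2014, Lemma 3.1] -/
def betaConst (p : ℕ) (c₀ e₀ τbar₀ α : F) : F :=
  α ^ p * c₀ / (τbar₀ + α * e₀) ^ p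

end Defs

/-- NAMED FACT — **Cutkosky 2014, Lemma 3.1** (for the algebraic local rings
`A = F[u,v]_{(u,v)} ⊆ B = F[x,y]_{(x,y)}` inside a field `L ⊇ F`, written with the coordinate
families `a = (u, v)`, `b = (x, y) : Fin 2 → L`; see the module docstring for the verbatim
statement and the rendering). Hypotheses: `char F = p`, `F` has at least three
elements, `B` dominates `A`, the expansions (4) hold in `B̂ = F[[x,y]]` with constants
`c₀, f₀, e₀`, unit series `τ₀(y)`, and `α ≠ 0, −τ̄₀/e₀`. Conclusions, with
`B_i = F[x_i,y_i]_{(x_i,y_i)}`, `A_p = F[u_p,v_p]_{(u_p,v_p)}` on the printed coordinates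
(`bCoord`) whenever these are algebraically independent: (C1) for `0 ≤ i < p` no quadratic
transform of `A` is dominated by `B_i`; (C2) `B_p` dominates `A_p`
(`β = αᵖc₀/(τ̄₀+αe₀)ᵖ`); (C3) the expansions (5), of the same form as (4), hold for
`(u_p, v_p)` in `B̂_p = F[[x_p, y_p]]`; (C4) `A → B_i` is not monomial for `0 ≤ i < p`.
Users take `(h : CutkoskyLemma31)`. [cite: Cutkosky2014, Lemma 3.1] -/
def CutkoskyLemma31 : Prop :=
  ∀ (F : Type u) [Field F] (p : ℕ) [Fact p.Prime] [CharP F p],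
    (∃ a b c : F, a ≠ b ∧ b ≠ c ∧ a ≠ c) →
  ∀ (L : Type u) [Field L] [Algebra F L] (a b : Fin 2 → L)
    (ha : AlgebraicIndependent F a) (hb : AlgebraicIndependent F b)
    (hAB : originLocalRing ha ≤ originLocalRing hb),
    Dominates F L (originLocalRing ha) (originLocalRing hb) →
  ∀ (c₀ f₀ e₀ : F) (τ₀ : MvPowerSeries (Fin 2) F),
    LemmaShape p hb ⟨a 0, hAB (mem_originLocalRing_self ha 0)⟩
      ⟨a 1, hAB (mem_originLocalRing_self ha 1)⟩ c₀ f₀ e₀ τ₀ →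
  ∀ (α : F), α ≠ 0 → α ≠ -(MvPowerSeries.constantCoeff τ₀) / e₀ →
    -- (C1) `B_i` dominates no quadratic transform of `A`, `0 ≤ i < p`
    (∀ i < p, ∀ (hB : AlgebraicIndependent F (bCoord F L p (b 0) (b 1) α i)) (A' : Subring L),
        IsQuadraticTransform (originLocalRing ha).toSubring A' →
        ¬ SubringDominates A' (originLocalRing hB).toSubring) ∧
    -- (C2) `B_p ⊇ A_p` with domination, and (C3) the expansions (5) in `B̂_p`
    (∀ (hB : AlgebraicIndependent F (bCoord F L p (b 0) (b 1) α p))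
        (hA : AlgebraicIndependent F
          (bCoord F L p (a 0) (a 1) (betaConst p c₀ e₀ (MvPowerSeries.constantCoeff τ₀) α) p)),
      ∃ hle : originLocalRing hA ≤ originLocalRing hB,
        Dominates F L (originLocalRing hA) (originLocalRing hB) ∧
        ∃ (c₁ f₁ e₁ : F) (τ₁ : MvPowerSeries (Fin 2) F),
          LemmaShape p hB ⟨_, hle (mem_originLocalRing_self hA 0)⟩
            ⟨_, hle (mem_originLocalRing_self hA 1)⟩ c₁ f₁ e₁ τ₁) ∧
    -- (C4) `A → B_i` is not monomial, `0 ≤ i < p`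
    (∀ i < p, ∀ (hB : AlgebraicIndependent F (bCoord F L p (b 0) (b 1) α i))
        (hle : originLocalRing ha ≤ originLocalRing hB),
        ¬ @IsMonomialExtension (originLocalRing ha) (originLocalRing hB) _ _ (inclusionAlgebra hle))

/-! ## Sanity lemmas on the coordinates -/

section Lemmas

variable {F : Type u} [Field F] {L : Type u} [Field L] [Algebra F L]

/-- For `i < p` the `B_i`-coordinates are `(x/yⁱ, y)`. [cite: Cutkosky2014, Lemma 3.1] -/
theorem bCoord_of_lt {p : ℕ} (x y : L) (α : F) {i : ℕ} (hi : i < p) :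
    bCoord F L p x y α i = ![x / y ^ i, y] := by
  simp [bCoord, hi]

/-- The `B_p`-coordinates are `(y, x/yᵖ − α)`. [cite: Cutkosky2014, Lemma 3.1] -/
theorem bCoord_self (p : ℕ) (x y : L) (α : F) :
    bCoord F L p x y α p = ![y, x / y ^ p - algebraMap F L α] := by
  simp [bCoord]

/-- `B₀ = B`: the `0`-th coordinates are `(x, y)` (for `p > 0`). [cite: Cutkosky2014, Lemma 3.1] -/
theorem bCoord_zero {p : ℕ} (hp : 0 < p) (x y : L) (α : F) : bCoord F L p x y α 0 = ![x, y] := by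
  simp [bCoord, hp]

/-- The printed substitution `x = x_i y_iⁱ`, `y = y_i` recovers `(x, y)` from the `B_i`-coordinates
(`y ≠ 0`). [cite: Cutkosky2014, Lemma 3.1] -/
theorem bCoord_subst_of_lt {p : ℕ} (x y : L) (hy : y ≠ 0) (α : F) {i : ℕ} (hi : i < p) :
    bCoord F L p x y α i 0 * bCoord F L p x y α i 1 ^ i = x ∧ bCoord F L p x y α i 1 = y := by
  simp [bCoord, hi, div_mul_cancel₀ _ (pow_ne_zero i hy)]

/-- The printed substitution `x = x_pᵖ(y_p + α)`, `y = x_p` recovers `(x, y)` from the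
`B_p`-coordinates (`y ≠ 0`). [cite: Cutkosky2014, Lemma 3.1] -/
theorem bCoord_subst_self (p : ℕ) (x y : L) (hy : y ≠ 0) (α : F) :
    bCoord F L p x y α p 0 ^ p * (bCoord F L p x y α p 1 + algebraMap F L α) = x ∧
      bCoord F L p x y α p 0 = y := by
  constructor
  · simp only [bCoord, lt_irrefl, if_false, Matrix.cons_val_zero, Matrix.cons_val_one]
    rw [sub_add_cancel, mul_comm, div_mul_cancel₀ _ (pow_ne_zero p hy)]
  · simp [bCoord]

end Lemmas

end Cutkosky

end Literature.Barriers.ResolutionOfSingularities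

end
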